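import Literature.Analysis.Calculus.SmoothCutoff
import Literature.Analysis.FluidPDE.BackwardUniquenessCutoff
import Literature.Analysis.FluidPDE.Wei2016HardyLemma
import HarnessLib

/-!
# Wei 2016, Lemma 2.3 for general `f`: the radial cut-off, the truncated Dirichlet form, and
# (2.3)–(2.4) along a ray

Analysis/FluidPDE proof file (theorems, plus the explicit cut-off and its derivatives as real
functions and the absolute constant `hardyConst`; no named facts) on the way to
`Literature.Analysis.FluidPDE.Wei2016_logModulus_regularity`
(`LeiZhang2017AxisymmetricCriteria.lean`), continuing `Wei2016HardyLemma.lean`, after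

* D. Wei, *Regularity criterion to the axially symmetric Navier–Stokes equations*, J. Math. Anal.
  Appl. 435 (2016) 402–413 = arXiv:1508.03318, §2, Lemma 2.3, displays (2.3)–(2.4) and the
  second half of its proof ("Now we discuss general `f`. Take a smooth cut-off function of `r`
  such that (i) `φ' ≤ 0`, (ii) `φ ≡ 1` if `0 ≤ r ≤ ½`, (iii) `φ ≡ 0` if `r ≥ 1` …").

> **Lemma 2.3.** Assume that `t > 0`, `‖Γ‖_{L^∞(r ≤ r₁)} ≤ ε ≤ 1`, and `0 < r₁ ≤ εK(ε)/a(t)`,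
> then `∫ (|u_θ(t)|/r)|f|² dx ≤ ε^{-1/3} ∫ |∂ᵣf|² dx + C (‖Γ‖_{L^∞} + ε^{-1/3})/r₁²
> ∫_{r ≥ r₁/2} |f|² dx` (2.3), `∫ |u_θ(t)|²|f|² dx ≤ ε^{2/3} ∫ |∂ᵣf|² dx
> + C (‖Γ‖²_{L^∞} + ε^{2/3})/r₁² ∫_{r ≥ r₁/2} |f|² dx` (2.4), for all axially symmetric scalar
> and vector functions `f ∈ H¹`.

As in `Wei2016HardyLemma.lean` everything is proved along a ray (`z` fixed, `dx = r dr dθ dz`),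
for the profile `w = |u_θ(·, z, t)|` and a `C¹` profile `f`, on a finite interval `[0, R]`,
`R ≥ r₁` (the printed integrals over `(0, ∞)` then follow by monotone convergence for `f ∈ H¹`,
in the three-dimensional transfer), and with the constant in the general form
`M = ε(1 + ln K + ½ (ln K)²)` for `K ≥ 1`, `r₁ ≤ εK/a` (`= ε^{-1/3}` for Wei's `K(ε)`):

* the cut-off: `Wei2016.radialCutoff r₁ r = smoothTransition (2 − 2r/r₁)` (Mathlib's smooth
  transition; `= 1` for `r ≤ r₁/2`, `= 0` for `r ≥ r₁`, values in `[0, 1]`), its derivatives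
  `radialCutoffDeriv`, `radialCutoffDeriv₂` with the chain rules, supports and the size bounds
  `|φ'| ≤ 2D/r₁`, `|φ''| ≤ 4D₂/r₁²` (`D`, `D₂` bounds for `|smoothTransition'|`,
  `|smoothTransition''|`; the latter from the tree's `Carleman.exists_bound_deriv_deriv_smoothTransition`,
  `BackwardUniquenessCutoff.lean`, reused);
* `Wei2016.abs_deriv_crossWeight_le`: `|∂ᵣ[r φ φ']| ≤ (4D + 4D² + 4D₂) r/r₁²`;
* `Wei2016.integral_mul_sq_deriv_trunc_le` — "and the fact that
  `∫ |∂ᵣ[φ(r/r₁) f]|² r dr ≤ ∫ |∂ᵣf|² r dr + (C/r₁²) ∫_{r ≥ r₁/2} |f|² r dr`" (expand, integrate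
  the cross term by parts);
* `Wei2016.integral_weight_mul_sq_le` — the cut-off argument for a general weight `ω` with
  `ω ≤ λw` on `[0, r₁]` and `rω ≤ Θ`;
* `Wei2016.integral_mul_sq_le_hardy_cutoff` — **(2.3) along a ray**:
  `∫₀ᴿ w f² ≤ M ∫₀ᴿ r f'² + C (Γ + M)/r₁² ∫_{r₁/2}^R f² r` (`Γ ≥ r w(r)`, i.e. `‖Γ‖_∞`);
* `Wei2016.integral_mul_sq_mul_sq_le_hardy_cutoff` — **(2.4) along a ray**:
  `∫₀ᴿ r w² f² ≤ εM ∫₀ᴿ r f'² + C (Γ² + εM)/r₁² ∫_{r₁/2}^R f² r`;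

with one absolute constant `C = Wei2016.hardyConst = max (8D₁² + 4D₁ + 4D₂) 4`.

## Mathlib / tree search

Tree: `Literature.Analysis.Calculus.SmoothCutoff` (`differentiable_smoothTransition`,
`deriv_smoothTransition_of_nonpos`, `deriv_smoothTransition_of_one_le`,
`exists_bound_deriv_smoothTransition`; its plateau `cutoff R` is two-sided, not the one-sided
radial cut-off needed here); `BackwardUniquenessCutoff.lean`
(`Carleman.exists_bound_deriv_deriv_smoothTransition`, reused; its vanishing lemmas for
`smoothTransition''` are for the open complement of `[0, 1]`, the closed versions needed at
`r = r₁/2` are proved here by one-sided uniqueness); `Wei2016HardyLemma.lean` (the core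
(2.5)–(2.8)). Mathlib:
`Real.smoothTransition` and its API, `intervalIntegral.integral_mul_deriv_eq_deriv_mul`,
`UniqueDiffWithinAt.eq_deriv` (one-sided uniqueness for `smoothTransition'' = 0` at `0`, `1`).

## References

* D. Wei, J. Math. Anal. Appl. 435 (2016) 402–413, arXiv:1508.03318, Lemma 2.3 ((2.3)–(2.4))
  and the second half of its proof. [Wei2016]
-/

noncomputable section

open MeasureTheory Set Filter Topology intervalIntegral
open Literature.Analysis.Calculus

namespace Literature.Analysis.FluidPDE

namespace Wei2016

/-! ### The second derivative of `Real.smoothTransition` -/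

/-- `(smoothTransition)'` is smooth. [folklore] -/
theorem contDiff_deriv_smoothTransition {n : ℕ∞} :
    ContDiff ℝ n (deriv Real.smoothTransition) :=
  (Real.smoothTransition.contDiff (n := n + 1)).deriv'

/-- `(smoothTransition)'` is differentiable. [folklore] -/
theorem differentiable_deriv_smoothTransition : Differentiable ℝ (deriv Real.smoothTransition) :=
  (contDiff_deriv_smoothTransition (n := 1)).differentiable (by simp)

/-- `(smoothTransition)'' = 0` on `(-∞, 0]` (the first derivative vanishes identically there; at
the endpoint by uniqueness of the one-sided derivative). [folklore] -/
theorem deriv_deriv_smoothTransition_of_nonpos {t : ℝ} (ht : t ≤ 0) :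
    deriv (deriv Real.smoothTransition) t = 0 := by
  have hD := (differentiable_deriv_smoothTransition t).hasDerivAt
  have h1 : HasDerivWithinAt (deriv Real.smoothTransition) (deriv (deriv Real.smoothTransition) t)
      (Iic t) t := hD.hasDerivWithinAt
  have h2 : HasDerivWithinAt (deriv Real.smoothTransition) 0 (Iic t) t :=
    (hasDerivWithinAt_const t (Iic t) (0 : ℝ)).congr_of_mem
      (fun s hs => deriv_smoothTransition_of_nonpos (le_trans hs ht)) self_mem_Iic
  exact (uniqueDiffWithinAt_Iic t).eq_deriv _ h1 h2

/-- `(smoothTransition)'' = 0` on `[1, ∞)`. [folklore] -/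
theorem deriv_deriv_smoothTransition_of_one_le {t : ℝ} (ht : 1 ≤ t) :
    deriv (deriv Real.smoothTransition) t = 0 := by
  have hD := (differentiable_deriv_smoothTransition t).hasDerivAt
  have h1 : HasDerivWithinAt (deriv Real.smoothTransition) (deriv (deriv Real.smoothTransition) t)
      (Ici t) t := hD.hasDerivWithinAt
  have h2 : HasDerivWithinAt (deriv Real.smoothTransition) 0 (Ici t) t :=
    (hasDerivWithinAt_const t (Ici t) (0 : ℝ)).congr_of_mem
      (fun s hs => deriv_smoothTransition_of_one_le (le_trans ht hs)) self_mem_Ici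
  exact (uniqueDiffWithinAt_Ici t).eq_deriv _ h1 h2

/-! ### The radial cut-off `φ(r/r₁)`, `φ(s) = smoothTransition (2 − 2s)` -/

/-- **The radial cut-off of the proof of Lemma 2.3**, `φ(r/r₁)` with
`φ(s) = smoothTransition (2 − 2s)`: a smooth function of `r` equal to `1` for `r ≤ r₁/2` and to
`0` for `r ≥ r₁` ("Take a smooth cut-off function of `r` such that … `φ ≡ 1` if `0 ≤ r ≤ ½`,
`φ ≡ 0` if `r ≥ 1`"). [cite: Wei2016, proof of Lemma 2.3 (the cut-off φ)] -/
def radialCutoff (r₁ r : ℝ) : ℝ :=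
  Real.smoothTransition (2 - 2 * (r / r₁))

/-- The derivative of the radial cut-off, `−(2/r₁) smoothTransition' (2 − 2r/r₁)`.
[cite: Wei2016, proof of Lemma 2.3 (the cut-off φ)] -/
def radialCutoffDeriv (r₁ r : ℝ) : ℝ :=
  deriv Real.smoothTransition (2 - 2 * (r / r₁)) * (-(2 / r₁))

/-- The second derivative of the radial cut-off, `(4/r₁²) smoothTransition'' (2 − 2r/r₁)`.
[cite: Wei2016, proof of Lemma 2.3 (the cut-off φ)] -/
def radialCutoffDeriv₂ (r₁ r : ℝ) : ℝ :=
  deriv (deriv Real.smoothTransition) (2 - 2 * (r / r₁)) * (-(2 / r₁)) * (-(2 / r₁))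

variable {r₁ : ℝ}

/-- The inner affine map `r ↦ 2 − 2r/r₁` has derivative `−2/r₁`. [folklore] -/
theorem hasDerivAt_two_sub (r₁ r : ℝ) :
    HasDerivAt (fun r : ℝ => 2 - 2 * (r / r₁)) (-(2 / r₁)) r := by
  have h := (((hasDerivAt_id' r).div_const r₁).const_mul (2 : ℝ)).const_sub (2 : ℝ)
  exact h.congr_deriv (by ring)

/-- `φ(r/r₁) = 1` for `r ≤ r₁/2`. [cite: Wei2016, proof of Lemma 2.3 (φ ≡ 1 on [0, 1/2])] -/
theorem radialCutoff_eq_one (hr₁ : 0 < r₁) {r : ℝ} (h : r ≤ r₁ / 2) : radialCutoff r₁ r = 1 := by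
  refine Real.smoothTransition.one_of_one_le ?_
  have : r / r₁ ≤ 1 / 2 := by
    rw [div_le_iff₀ hr₁]
    linarith
  linarith

/-- `φ(r/r₁) = 0` for `r ≥ r₁`. [cite: Wei2016, proof of Lemma 2.3 (φ ≡ 0 on [1, ∞))] -/
theorem radialCutoff_eq_zero (hr₁ : 0 < r₁) {r : ℝ} (h : r₁ ≤ r) : radialCutoff r₁ r = 0 := by
  refine Real.smoothTransition.zero_of_nonpos ?_
  have : 1 ≤ r / r₁ := by
    rw [le_div_iff₀ hr₁]
    linarith
  linarith

/-- `0 ≤ φ ≤ 1`. [folklore] -/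
theorem radialCutoff_nonneg (r₁ r : ℝ) : 0 ≤ radialCutoff r₁ r :=
  Real.smoothTransition.nonneg _

/-- `φ ≤ 1`. [folklore] -/
theorem radialCutoff_le_one (r₁ r : ℝ) : radialCutoff r₁ r ≤ 1 :=
  Real.smoothTransition.le_one _

/-- The chain rule for the radial cut-off. [folklore] -/
theorem hasDerivAt_radialCutoff (r₁ r : ℝ) :
    HasDerivAt (radialCutoff r₁) (radialCutoffDeriv r₁ r) r :=
  (differentiable_smoothTransition _).hasDerivAt.comp r (hasDerivAt_two_sub r₁ r)

/-- The chain rule for the derivative of the radial cut-off. [folklore] -/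
theorem hasDerivAt_radialCutoffDeriv (r₁ r : ℝ) :
    HasDerivAt (radialCutoffDeriv r₁) (radialCutoffDeriv₂ r₁ r) r :=
  ((differentiable_deriv_smoothTransition _).hasDerivAt.comp r (hasDerivAt_two_sub r₁ r)).mul_const
    _

/-- The radial cut-off is differentiable. [folklore] -/
theorem differentiable_radialCutoff (r₁ : ℝ) : Differentiable ℝ (radialCutoff r₁) := fun r =>
  (hasDerivAt_radialCutoff r₁ r).differentiableAt

/-- `φ'` is continuous. [folklore] -/
theorem continuous_radialCutoffDeriv (r₁ : ℝ) : Continuous (radialCutoffDeriv r₁) :=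
  continuous_iff_continuousAt.2 fun r => (hasDerivAt_radialCutoffDeriv r₁ r).continuousAt

/-- `φ''` is continuous. [folklore] -/
theorem continuous_radialCutoffDeriv₂ (r₁ : ℝ) : Continuous (radialCutoffDeriv₂ r₁) := by
  have hc : Continuous (deriv (deriv Real.smoothTransition)) :=
    (contDiff_deriv_smoothTransition (n := 1)).continuous_deriv le_rfl
  unfold radialCutoffDeriv₂
  fun_prop

/-- `φ'(r/r₁) = 0` for `r ≤ r₁/2`. [folklore] -/
theorem radialCutoffDeriv_eq_zero_of_le (hr₁ : 0 < r₁) {r : ℝ} (h : r ≤ r₁ / 2) :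
    radialCutoffDeriv r₁ r = 0 := by
  have : 1 ≤ 2 - 2 * (r / r₁) := by
    have : r / r₁ ≤ 1 / 2 := by
      rw [div_le_iff₀ hr₁]
      linarith
    linarith
  rw [radialCutoffDeriv, deriv_smoothTransition_of_one_le this, zero_mul]

/-- `φ'(r/r₁) = 0` for `r ≥ r₁`. [folklore] -/
theorem radialCutoffDeriv_eq_zero_of_ge (hr₁ : 0 < r₁) {r : ℝ} (h : r₁ ≤ r) :
    radialCutoffDeriv r₁ r = 0 := by
  have : 2 - 2 * (r / r₁) ≤ 0 := by
    have : 1 ≤ r / r₁ := by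
      rw [le_div_iff₀ hr₁]
      linarith
    linarith
  rw [radialCutoffDeriv, deriv_smoothTransition_of_nonpos this, zero_mul]

/-- `φ''(r/r₁) = 0` for `r ≤ r₁/2`. [folklore] -/
theorem radialCutoffDeriv₂_eq_zero_of_le (hr₁ : 0 < r₁) {r : ℝ} (h : r ≤ r₁ / 2) :
    radialCutoffDeriv₂ r₁ r = 0 := by
  have : 1 ≤ 2 - 2 * (r / r₁) := by
    have : r / r₁ ≤ 1 / 2 := by
      rw [div_le_iff₀ hr₁]
      linarith
    linarith
  rw [radialCutoffDeriv₂, deriv_deriv_smoothTransition_of_one_le this, zero_mul, zero_mul]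

/-- **Size of `φ'`**: `|φ'(r/r₁)| ≤ 2D/r₁` with `D` a bound for `|smoothTransition'|`. [folklore] -/
theorem abs_radialCutoffDeriv_le (hr₁ : 0 < r₁) {D : ℝ}
    (hD : ∀ t, |deriv Real.smoothTransition t| ≤ D) (r : ℝ) :
    |radialCutoffDeriv r₁ r| ≤ 2 * D / r₁ := by
  rw [radialCutoffDeriv, abs_mul, abs_neg, abs_of_pos (div_pos two_pos hr₁)]
  have h := hD (2 - 2 * (r / r₁))
  calc |deriv Real.smoothTransition (2 - 2 * (r / r₁))| * (2 / r₁) ≤ D * (2 / r₁) := by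
        gcongr
    _ = 2 * D / r₁ := by ring

/-- **Size of `φ''`**: `|φ''(r/r₁)| ≤ 4D₂/r₁²` with `D₂` a bound for `|smoothTransition''|`.
[folklore] -/
theorem abs_radialCutoffDeriv₂_le (hr₁ : 0 < r₁) {D₂ : ℝ}
    (hD₂ : ∀ t, |deriv (deriv Real.smoothTransition) t| ≤ D₂) (r : ℝ) :
    |radialCutoffDeriv₂ r₁ r| ≤ 4 * D₂ / r₁ ^ 2 := by
  rw [radialCutoffDeriv₂, mul_assoc, abs_mul, show -(2 / r₁) * -(2 / r₁) = 4 / r₁ ^ 2 by ring,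
    abs_of_pos (by positivity : (0 : ℝ) < 4 / r₁ ^ 2)]
  have h := hD₂ (2 - 2 * (r / r₁))
  calc |deriv (deriv Real.smoothTransition) (2 - 2 * (r / r₁))| * (4 / r₁ ^ 2)
      ≤ D₂ * (4 / r₁ ^ 2) := by gcongr
    _ = 4 * D₂ / r₁ ^ 2 := by ring

/-! ### The weight `r φ φ'` of the cross term and its derivative -/

/-- **The derivative of the cross-term weight `r φ(r/r₁) φ'(r/r₁)`** (product rule).
[cite: Wei2016, proof of Lemma 2.3 (display with ∂ᵣ[φ φ' r])] -/
theorem hasDerivAt_crossWeight (r₁ r : ℝ) :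
    HasDerivAt (fun y : ℝ => y * radialCutoff r₁ y * radialCutoffDeriv r₁ y)
      (radialCutoff r₁ r * radialCutoffDeriv r₁ r +
        r * (radialCutoffDeriv r₁ r ^ 2 + radialCutoff r₁ r * radialCutoffDeriv₂ r₁ r)) r := by
  have h := ((hasDerivAt_id' r).fun_mul (hasDerivAt_radialCutoff r₁ r)).fun_mul
    (hasDerivAt_radialCutoffDeriv r₁ r)
  exact h.congr_deriv (by ring)

/-- **Size of `∂ᵣ[r φ φ']`**: with bounds `D`, `D₂` for `|smoothTransition'|`,
`|smoothTransition''|`, for `r ≥ 0`,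
`|∂ᵣ[r φ(r/r₁) φ'(r/r₁)]| ≤ (4D + 4D² + 4D₂) r/r₁²` (the derivative vanishes for `r ≤ r₁/2`, and
for `r ≥ r₁/2` one has `1/r₁ ≤ 2r/r₁²`) — the constant `C/r₁²` of
"`−∫ |f|² ∂ᵣ[φ φ' r] dr dz ≤ (C/r₁²) ∫_{r ≥ r₁/2} |f|² r dr dz`".
[cite: Wei2016, proof of Lemma 2.3 (display with ∂ᵣ[φ φ' r])] -/
theorem abs_deriv_crossWeight_le (hr₁ : 0 < r₁) {D D₂ : ℝ} (hD0 : 0 ≤ D)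
    (hD : ∀ t, |deriv Real.smoothTransition t| ≤ D)
    (hD₂ : ∀ t, |deriv (deriv Real.smoothTransition) t| ≤ D₂) {r : ℝ} (hr : 0 ≤ r) :
    |radialCutoff r₁ r * radialCutoffDeriv r₁ r +
        r * (radialCutoffDeriv r₁ r ^ 2 + radialCutoff r₁ r * radialCutoffDeriv₂ r₁ r)| ≤
      (4 * D + 4 * D ^ 2 + 4 * D₂) * r / r₁ ^ 2 := by
  have hD₂0 : 0 ≤ D₂ := (abs_nonneg _).trans (hD₂ 0)
  rcases le_or_gt r (r₁ / 2) with hle | hgt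
  · rw [radialCutoffDeriv_eq_zero_of_le hr₁ hle, radialCutoffDeriv₂_eq_zero_of_le hr₁ hle]
    simp only [mul_zero, zero_pow two_ne_zero, zero_add, abs_zero]
    positivity
  · have hφ : |radialCutoff r₁ r| ≤ 1 := by
      rw [abs_of_nonneg (radialCutoff_nonneg r₁ r)]
      exact radialCutoff_le_one r₁ r
    have hφd := abs_radialCutoffDeriv_le hr₁ hD r
    have hφdd := abs_radialCutoffDeriv₂_le hr₁ hD₂ r
    have h2r : 1 / r₁ ≤ 2 * r / r₁ ^ 2 := by
      rw [div_le_div_iff₀ hr₁ (by positivity)]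
      nlinarith
    have hA : |radialCutoff r₁ r * radialCutoffDeriv r₁ r| ≤ 4 * D * r / r₁ ^ 2 := by
      rw [abs_mul]
      calc |radialCutoff r₁ r| * |radialCutoffDeriv r₁ r| ≤ 1 * (2 * D / r₁) :=
            mul_le_mul hφ hφd (abs_nonneg _) zero_le_one
        _ = 2 * D * (1 / r₁) := by ring
        _ ≤ 2 * D * (2 * r / r₁ ^ 2) := by gcongr
        _ = 4 * D * r / r₁ ^ 2 := by ring
    have hB : |r * radialCutoffDeriv r₁ r ^ 2| ≤ 4 * D ^ 2 * r / r₁ ^ 2 := by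
      rw [abs_mul, abs_of_nonneg hr, abs_of_nonneg (sq_nonneg _)]
      have h1 : radialCutoffDeriv r₁ r ^ 2 ≤ (2 * D / r₁) ^ 2 := by
        rw [← sq_abs]
        exact pow_le_pow_left₀ (abs_nonneg _) hφd 2
      calc r * radialCutoffDeriv r₁ r ^ 2 ≤ r * (2 * D / r₁) ^ 2 := by gcongr
        _ = 4 * D ^ 2 * r / r₁ ^ 2 := by ring
    have hC : |r * (radialCutoff r₁ r * radialCutoffDeriv₂ r₁ r)| ≤ 4 * D₂ * r / r₁ ^ 2 := by
      rw [abs_mul, abs_of_nonneg hr, abs_mul]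
      calc r * (|radialCutoff r₁ r| * |radialCutoffDeriv₂ r₁ r|) ≤ r * (1 * (4 * D₂ / r₁ ^ 2)) := by
            gcongr
        _ = 4 * D₂ * r / r₁ ^ 2 := by ring
    calc |radialCutoff r₁ r * radialCutoffDeriv r₁ r +
          r * (radialCutoffDeriv r₁ r ^ 2 + radialCutoff r₁ r * radialCutoffDeriv₂ r₁ r)|
        ≤ |radialCutoff r₁ r * radialCutoffDeriv r₁ r| +
            (|r * radialCutoffDeriv r₁ r ^ 2| + |r * (radialCutoff r₁ r * radialCutoffDeriv₂ r₁ r)|) := by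
          rw [mul_add]
          exact (abs_add_le _ _).trans (add_le_add le_rfl (abs_add_le _ _))
      _ ≤ 4 * D * r / r₁ ^ 2 + (4 * D ^ 2 * r / r₁ ^ 2 + 4 * D₂ * r / r₁ ^ 2) :=
          add_le_add hA (add_le_add hB hC)
      _ = (4 * D + 4 * D ^ 2 + 4 * D₂) * r / r₁ ^ 2 := by ring

/-! ### The Dirichlet form of the truncation `φ(r/r₁) f` -/

/-- **"∫ |∂ᵣ[φ(r/r₁) f]|² r dr ≤ ∫ |∂ᵣf|² r dr + (C/r₁²) ∫_{r ≥ r₁/2} |f|² r dr"** (Wei 2016, proof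
of Lemma 2.3, last display of the proof of (2.3)), along a ray and on `[0, r₁]` (where the
truncation lives): for `f` differentiable with continuous derivative,
`∫₀^{r₁} r (φ' f + φ f')² ≤ ∫₀^{r₁} r f'² + ((8D² + 4D + 4D₂)/r₁²) ∫_{r₁/2}^{r₁} f² r`, with `D`,
`D₂` bounds for `|smoothTransition'|`, `|smoothTransition''|`. Proof as printed: expand the square;
`φ² ≤ 1`; the cross term `∫ r φ φ' ∂ᵣ(f²) = −∫ ∂ᵣ[r φ φ'] f²` (integration by parts, no boundary
terms since `φ(r₁/r₁) = 0` and the weight has the factor `r`) is bounded by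
`abs_deriv_crossWeight_le`; `r φ'² f² ≤ (4D²/r₁²) r f²`; both error terms live on `[r₁/2, r₁]`.
[cite: Wei2016, proof of Lemma 2.3 (last display of the proof of (2.3))] -/
theorem integral_mul_sq_deriv_trunc_le (hr₁ : 0 < r₁) {D D₂ : ℝ} (hD0 : 0 ≤ D)
    (hD : ∀ t, |deriv Real.smoothTransition t| ≤ D)
    (hD₂ : ∀ t, |deriv (deriv Real.smoothTransition) t| ≤ D₂) {f f' : ℝ → ℝ}
    (hf : ∀ r, HasDerivAt f (f' r) r) (hf' : Continuous f') :
    ∫ r in (0 : ℝ)..r₁, r * (radialCutoffDeriv r₁ r * f r + radialCutoff r₁ r * f' r) ^ 2 ≤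
      (∫ r in (0 : ℝ)..r₁, r * f' r ^ 2) +
        (8 * D ^ 2 + 4 * D + 4 * D₂) / r₁ ^ 2 * ∫ r in (r₁ / 2)..r₁, f r ^ 2 * r := by
  set φ := radialCutoff r₁ with hφ
  set φd := radialCutoffDeriv r₁ with hφd
  set φdd := radialCutoffDeriv₂ r₁ with hφdd
  have hfc : Continuous f := continuous_iff_continuousAt.2 fun r => (hf r).continuousAt
  have hφc : Continuous φ := (differentiable_radialCutoff r₁).continuous
  have hφdc : Continuous φd := continuous_radialCutoffDeriv r₁
  have hφddc : Continuous φdd := continuous_radialCutoffDeriv₂ r₁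
  have hint : ∀ {g : ℝ → ℝ}, Continuous g → ∀ a b : ℝ, IntervalIntegrable g volume a b :=
    fun hg a b => hg.intervalIntegrable a b
  have hr₁2 : 0 ≤ r₁ / 2 := by positivity
  have hhalf : r₁ / 2 ≤ r₁ := by linarith
  -- the cross-term weight `P = r φ φ'` and its derivative
  set P : ℝ → ℝ := fun y => y * φ y * φd y with hP
  set P' : ℝ → ℝ := fun y => φ y * φd y + y * (φd y ^ 2 + φ y * φdd y) with hP'
  have hPd : ∀ y, HasDerivAt P (P' y) y := fun y => hasDerivAt_crossWeight r₁ y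
  have hP'c : Continuous P' := by
    simp only [hP']
    fun_prop
  have hP0 : P 0 = 0 := by simp [hP]
  have hPr₁ : P r₁ = 0 := by
    simp only [hP, hφ, radialCutoff_eq_zero hr₁ le_rfl, mul_zero, zero_mul]
  have hP'zero : ∀ y, y ≤ r₁ / 2 → P' y = 0 := by
    intro y hy
    simp only [hP', hφd, hφdd, radialCutoffDeriv_eq_zero_of_le hr₁ hy,
      radialCutoffDeriv₂_eq_zero_of_le hr₁ hy]
    ring
  have hP'bound : ∀ y, 0 ≤ y → |P' y| ≤ (4 * D + 4 * D ^ 2 + 4 * D₂) * y / r₁ ^ 2 :=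
    fun y hy => abs_deriv_crossWeight_le hr₁ hD0 hD hD₂ hy
  have hφdzero : ∀ y, y ≤ r₁ / 2 → φd y = 0 := fun y hy => radialCutoffDeriv_eq_zero_of_le hr₁ hy
  have hφdbound : ∀ y, |φd y| ≤ 2 * D / r₁ := fun y => abs_radialCutoffDeriv_le hr₁ hD y
  -- the common error integral
  set X : ℝ := ∫ r in (r₁ / 2)..r₁, f r ^ 2 * r with hX
  have hX0 : 0 ≤ X := intervalIntegral.integral_nonneg hhalf fun r hr => by
    have : 0 ≤ r := hr₁2.trans hr.1
    positivity
  -- pointwise expansion of the integrand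
  have hexp : (fun r => r * (φd r * f r + φ r * f' r) ^ 2) = fun r =>
      (r * φ r ^ 2 * f' r ^ 2 + P r * (f' r * f r + f r * f' r)) + r * φd r ^ 2 * f r ^ 2 := by
    funext r
    simp only [hP]
    ring
  -- (1) `∫ r φ² f'² ≤ ∫ r f'²`
  have hI1 : ∫ r in (0 : ℝ)..r₁, r * φ r ^ 2 * f' r ^ 2 ≤ ∫ r in (0 : ℝ)..r₁, r * f' r ^ 2 := by
    refine integral_mono_on hr₁.le (hint (by fun_prop) _ _) (hint (by fun_prop) _ _) fun r hr => ?_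
    have hsq : φ r ^ 2 ≤ 1 := pow_le_one₀ (radialCutoff_nonneg r₁ r) (radialCutoff_le_one r₁ r)
    have h0 : 0 ≤ r * f' r ^ 2 := mul_nonneg hr.1 (sq_nonneg _)
    calc r * φ r ^ 2 * f' r ^ 2 = φ r ^ 2 * (r * f' r ^ 2) := by ring
      _ ≤ 1 * (r * f' r ^ 2) := mul_le_mul_of_nonneg_right hsq h0
      _ = r * f' r ^ 2 := one_mul _
  -- (2) the cross term, by parts
  have hI2 : ∫ r in (0 : ℝ)..r₁, P r * (f' r * f r + f r * f' r) ≤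
      (4 * D + 4 * D ^ 2 + 4 * D₂) / r₁ ^ 2 * X := by
    have hibp := integral_mul_deriv_eq_deriv_mul (a := 0) (b := r₁) (u := P) (u' := P')
      (v := fun y => f y * f y) (v' := fun y => f' y * f y + f y * f' y)
      (fun y _ => hPd y) (fun y _ => (hf y).fun_mul (hf y)) (hint hP'c _ _)
      (hint (by fun_prop) _ _)
    rw [hibp, hPr₁, hP0, zero_mul, zero_mul, sub_zero, zero_sub]
    -- `-∫ P' f² ≤ ∫ |P'| f²`
    have h1 : -∫ r in (0 : ℝ)..r₁, P' r * (f r * f r) ≤ ∫ r in (0 : ℝ)..r₁, |P' r| * f r ^ 2 := by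
      rw [← intervalIntegral.integral_neg]
      refine integral_mono_on hr₁.le (hint (by fun_prop) _ _) (hint (by fun_prop) _ _)
        fun r _ => ?_
      have : -(P' r * (f r * f r)) = -P' r * f r ^ 2 := by ring
      rw [this]
      exact mul_le_mul_of_nonneg_right (neg_le_abs _) (sq_nonneg _)
    -- split at `r₁/2`; the first part vanishes
    have hsplit : ∫ r in (0 : ℝ)..r₁, |P' r| * f r ^ 2 =
        (∫ r in (0 : ℝ)..(r₁ / 2), |P' r| * f r ^ 2) + ∫ r in (r₁ / 2)..r₁, |P' r| * f r ^ 2 :=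
      (integral_add_adjacent_intervals (hint (by fun_prop) _ _) (hint (by fun_prop) _ _)).symm
    have hzero : ∫ r in (0 : ℝ)..(r₁ / 2), |P' r| * f r ^ 2 = 0 := by
      rw [integral_congr (g := fun _ => (0 : ℝ)) fun r hr => ?_, intervalIntegral.integral_zero]
      rw [uIcc_of_le hr₁2] at hr
      simp only [hP'zero r hr.2, abs_zero, zero_mul]
    have h2 : ∫ r in (r₁ / 2)..r₁, |P' r| * f r ^ 2 ≤ (4 * D + 4 * D ^ 2 + 4 * D₂) / r₁ ^ 2 * X := by
      rw [hX, ← intervalIntegral.integral_const_mul]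
      refine integral_mono_on hhalf (hint (by fun_prop) _ _) (hint (by fun_prop) _ _) fun r hr => ?_
      have hr0 : 0 ≤ r := hr₁2.trans hr.1
      calc |P' r| * f r ^ 2 ≤ (4 * D + 4 * D ^ 2 + 4 * D₂) * r / r₁ ^ 2 * f r ^ 2 :=
            mul_le_mul_of_nonneg_right (hP'bound r hr0) (sq_nonneg _)
        _ = (4 * D + 4 * D ^ 2 + 4 * D₂) / r₁ ^ 2 * (f r ^ 2 * r) := by ring
    linarith
  -- (3) `∫ r φ'² f² ≤ (4D²/r₁²) X`
  have hI3 : ∫ r in (0 : ℝ)..r₁, r * φd r ^ 2 * f r ^ 2 ≤ 4 * D ^ 2 / r₁ ^ 2 * X := by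
    have hsplit : ∫ r in (0 : ℝ)..r₁, r * φd r ^ 2 * f r ^ 2 =
        (∫ r in (0 : ℝ)..(r₁ / 2), r * φd r ^ 2 * f r ^ 2) + ∫ r in (r₁ / 2)..r₁, r * φd r ^ 2 * f r ^ 2 :=
      (integral_add_adjacent_intervals (hint (by fun_prop) _ _) (hint (by fun_prop) _ _)).symm
    have hzero : ∫ r in (0 : ℝ)..(r₁ / 2), r * φd r ^ 2 * f r ^ 2 = 0 := by
      rw [integral_congr (g := fun _ => (0 : ℝ)) fun r hr => ?_, intervalIntegral.integral_zero]
      rw [uIcc_of_le hr₁2] at hr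
      simp only [hφdzero r hr.2, zero_pow two_ne_zero, mul_zero, zero_mul]
    have h2 : ∫ r in (r₁ / 2)..r₁, r * φd r ^ 2 * f r ^ 2 ≤ 4 * D ^ 2 / r₁ ^ 2 * X := by
      rw [hX, ← intervalIntegral.integral_const_mul]
      refine integral_mono_on hhalf (hint (by fun_prop) _ _) (hint (by fun_prop) _ _) fun r hr => ?_
      have hr0 : 0 ≤ r := hr₁2.trans hr.1
      have hsq : φd r ^ 2 ≤ (2 * D / r₁) ^ 2 := by
        rw [← sq_abs]
        exact pow_le_pow_left₀ (abs_nonneg _) (hφdbound r) 2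
      calc r * φd r ^ 2 * f r ^ 2 ≤ r * (2 * D / r₁) ^ 2 * f r ^ 2 := by gcongr
        _ = 4 * D ^ 2 / r₁ ^ 2 * (f r ^ 2 * r) := by ring
    linarith
  -- assemble
  rw [hexp, intervalIntegral.integral_add (hint (by fun_prop) _ _) (hint (by fun_prop) _ _),
    intervalIntegral.integral_add (hint (by fun_prop) _ _) (hint (by fun_prop) _ _)]
  have hC : (4 * D + 4 * D ^ 2 + 4 * D₂) / r₁ ^ 2 * X + 4 * D ^ 2 / r₁ ^ 2 * X =
      (8 * D ^ 2 + 4 * D + 4 * D₂) / r₁ ^ 2 * X := by ring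
  linarith

/-! ### The absolute constant of (2.3)–(2.4) -/

/-- A bound `D₁` for `|smoothTransition'|` (from `exists_bound_deriv_smoothTransition`). [folklore] -/
def stDerivBound : ℝ :=
  Classical.choose exists_bound_deriv_smoothTransition

/-- `0 ≤ D₁` and `|smoothTransition'| ≤ D₁`. [folklore] -/
theorem stDerivBound_spec :
    0 ≤ stDerivBound ∧ ∀ t, |deriv Real.smoothTransition t| ≤ stDerivBound :=
  Classical.choose_spec exists_bound_deriv_smoothTransition

/-- A bound `D₂` for `|smoothTransition''|` (from the tree's
`Carleman.exists_bound_deriv_deriv_smoothTransition`, `BackwardUniquenessCutoff.lean`). [folklore] -/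
def stDeriv₂Bound : ℝ :=
  Classical.choose Carleman.exists_bound_deriv_deriv_smoothTransition

/-- `0 ≤ D₂` and `|smoothTransition''| ≤ D₂`. [folklore] -/
theorem stDeriv₂Bound_spec :
    0 ≤ stDeriv₂Bound ∧ ∀ t, |deriv (deriv Real.smoothTransition) t| ≤ stDeriv₂Bound :=
  Classical.choose_spec Carleman.exists_bound_deriv_deriv_smoothTransition

/-- **The absolute constant `C` of Lemma 2.3, (2.3)–(2.4)**:
`C = max (8D₁² + 4D₁ + 4D₂) 4` (the truncation constant of `integral_mul_sq_deriv_trunc_le` and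
the factor `4` of `|Γ|/r² ≤ 4|Γ| r/r₁² … ` on `r ≥ r₁/2`). [cite: Wei2016, Lemma 2.3 ((2.3)–(2.4), the constant C)] -/
def hardyConst : ℝ :=
  max (8 * stDerivBound ^ 2 + 4 * stDerivBound + 4 * stDeriv₂Bound) 4

/-- `4 ≤ C`. [folklore] -/
theorem four_le_hardyConst : 4 ≤ hardyConst :=
  le_max_right _ _

/-- `0 ≤ C`. [folklore] -/
theorem hardyConst_nonneg : 0 ≤ hardyConst :=
  le_trans (by norm_num) four_le_hardyConst

/-- The truncation constant is `≤ C`. [folklore] -/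
theorem truncConst_le_hardyConst :
    8 * stDerivBound ^ 2 + 4 * stDerivBound + 4 * stDeriv₂Bound ≤ hardyConst :=
  le_max_left _ _

/-! ### Lemma 2.3 for general `f`: (2.3) and (2.4) along a ray -/

/-- **The cut-off argument of Lemma 2.3 ("Now we discuss general `f`"), general weight.** Let `w`
be the profile of `|u_θ|` along a ray as in `integral_mul_sq_le_hardy` (`w ≤ ε/r`, `∫₀ʳ w ≤ r a`
on `(0, r₁]`, `0 < r₁ ≤ εK/a`), and let `ω ≥ 0` be a continuous weight with `ω ≤ λ w` on `[0, r₁]`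
and `r ω(r) ≤ Θ` for `r > 0`. Then for `f` differentiable with continuous derivative and
`R ≥ r₁`, with `M = ε(1 + ln K + ½ (ln K)²)` and `C₁ = 8D² + 4D + 4D₂`,
`∫₀ᴿ ω f² ≤ λM ∫₀ᴿ r f'² + ((λ M C₁ + 4Θ)/r₁²) ∫_{r₁/2}^R f² r`.
Proof as printed: `ω f² = ω (φf)² + ω (1 − φ²) f²` with `φ = φ(r/r₁)`; the first term is
supported in `[0, r₁]`, where `ω ≤ λ w` and the ray inequality (2.5) applies to `φ f`
(`integral_mul_sq_le_hardy`), followed by the truncation estimate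
(`integral_mul_sq_deriv_trunc_le`); the second is supported in `r ≥ r₁/2`, where
`ω ≤ Θ/r ≤ 4Θ r/r₁²`. The cases `(ω, λ, Θ) = (w, 1, ‖Γ‖_∞)` and `(r w², ε, ‖Γ‖²_∞)` are (2.3)
and (2.4). [cite: Wei2016, proof of Lemma 2.3 ("Now we discuss general f")] -/
theorem integral_weight_mul_sq_le {w ω f f' : ℝ → ℝ} {ε a K r₁ R lam Θ D D₂ : ℝ} (hε : 0 < ε)
    (ha : 0 < a) (hK : 1 ≤ K) (hr₁ : 0 < r₁) (hr₁K : r₁ ≤ ε * K / a) (hR : r₁ ≤ R)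
    (hw : Continuous w) (hw0 : ∀ r, 0 ≤ w r) (hwε : ∀ r ∈ Ioc 0 r₁, w r ≤ ε / r)
    (hV : ∀ r ∈ Ioc 0 r₁, ∫ s in (0 : ℝ)..r, w s ≤ r * a)
    (hω : Continuous ω) (hω0 : ∀ r, 0 ≤ ω r) (hlam : 0 ≤ lam)
    (hωw : ∀ r ∈ Icc 0 r₁, ω r ≤ lam * w r) (hΘ : 0 ≤ Θ) (hωΘ : ∀ r, 0 < r → r * ω r ≤ Θ)
    (hf : ∀ r, HasDerivAt f (f' r) r) (hf' : Continuous f') (hD0 : 0 ≤ D)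
    (hD : ∀ t, |deriv Real.smoothTransition t| ≤ D)
    (hD₂ : ∀ t, |deriv (deriv Real.smoothTransition) t| ≤ D₂) :
    ∫ r in (0 : ℝ)..R, ω r * f r ^ 2 ≤
      lam * (ε * (1 + Real.log K + Real.log K ^ 2 / 2)) * (∫ r in (0 : ℝ)..R, r * f' r ^ 2) +
        (lam * (ε * (1 + Real.log K + Real.log K ^ 2 / 2)) * (8 * D ^ 2 + 4 * D + 4 * D₂) +
            4 * Θ) / r₁ ^ 2 * ∫ r in (r₁ / 2)..R, f r ^ 2 * r := by
  set M : ℝ := ε * (1 + Real.log K + Real.log K ^ 2 / 2) with hMdef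
  set C₁ : ℝ := 8 * D ^ 2 + 4 * D + 4 * D₂ with hC₁def
  set φ := radialCutoff r₁ with hφ
  set φd := radialCutoffDeriv r₁ with hφd
  have hfc : Continuous f := continuous_iff_continuousAt.2 fun r => (hf r).continuousAt
  have hφc : Continuous φ := (differentiable_radialCutoff r₁).continuous
  have hφdc : Continuous φd := continuous_radialCutoffDeriv r₁
  have hint : ∀ {g : ℝ → ℝ}, Continuous g → ∀ a b : ℝ, IntervalIntegrable g volume a b :=
    fun hg a b => hg.intervalIntegrable a b
  have hR0 : 0 ≤ R := hr₁.le.trans hR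
  have hr₁2 : 0 ≤ r₁ / 2 := by positivity
  have hhalf : r₁ / 2 ≤ r₁ := by linarith
  have hhalfR : r₁ / 2 ≤ R := hhalf.trans hR
  have hlogK : 0 ≤ Real.log K := Real.log_nonneg hK
  have hM0 : 0 ≤ M := by positivity
  have hD₂0 : 0 ≤ D₂ := (abs_nonneg _).trans (hD₂ 0)
  have hC₁0 : 0 ≤ C₁ := by positivity
  -- the truncation `g = φ f`
  set g : ℝ → ℝ := fun r => φ r * f r with hg
  set g' : ℝ → ℝ := fun r => φd r * f r + φ r * f' r with hg'
  have hgd : ∀ r, HasDerivAt g (g' r) r := fun r => (hasDerivAt_radialCutoff r₁ r).fun_mul (hf r)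
  have hg'c : Continuous g' := by
    simp only [hg']
    fun_prop
  have hgc : Continuous g := by
    simp only [hg]
    fun_prop
  have hgr₁ : g r₁ = 0 := by
    simp only [hg, hφ, radialCutoff_eq_zero hr₁ le_rfl, zero_mul]
  have hgzero : ∀ r, r₁ ≤ r → g r = 0 := fun r hr => by
    simp only [hg, hφ, radialCutoff_eq_zero hr₁ hr, zero_mul]
  -- the error integral and the two monotonicity facts in `R`
  set X : ℝ := ∫ r in (r₁ / 2)..R, f r ^ 2 * r with hX
  have hX0 : 0 ≤ X := intervalIntegral.integral_nonneg hhalfR fun r hr => by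
    have : 0 ≤ r := hr₁2.trans hr.1
    positivity
  have hX₁ : ∫ r in (r₁ / 2)..r₁, f r ^ 2 * r ≤ X := by
    refine integral_mono_interval le_rfl hhalf hR ?_ (hint (by fun_prop) _ _)
    filter_upwards [ae_restrict_mem measurableSet_Ioc] with r hr
    have : 0 ≤ r := hr₁2.trans hr.1.le
    positivity
  have hE₁ : ∫ r in (0 : ℝ)..r₁, r * f' r ^ 2 ≤ ∫ r in (0 : ℝ)..R, r * f' r ^ 2 := by
    refine integral_mono_interval le_rfl hr₁.le hR ?_ (hint (by fun_prop) _ _)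
    filter_upwards [ae_restrict_mem measurableSet_Ioc] with r hr
    have : 0 ≤ r := hr.1.le
    positivity
  -- (2.5) for `g` and the truncation estimate
  have hcore : ∫ r in (0 : ℝ)..r₁, w r * g r ^ 2 ≤ M * ∫ r in (0 : ℝ)..r₁, r * g' r ^ 2 :=
    integral_mul_sq_le_hardy hε ha hK hr₁ hr₁K hw hw0 hwε hV hgd hg'c hgr₁
  have htrunc : ∫ r in (0 : ℝ)..r₁, r * g' r ^ 2 ≤
      (∫ r in (0 : ℝ)..r₁, r * f' r ^ 2) + C₁ / r₁ ^ 2 * ∫ r in (r₁ / 2)..r₁, f r ^ 2 * r :=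
    integral_mul_sq_deriv_trunc_le hr₁ hD0 hD hD₂ hf hf'
  -- (i) split `ω f² = ω g² + ω (1 - φ²) f²`
  have hsplit : ∫ r in (0 : ℝ)..R, ω r * f r ^ 2 =
      (∫ r in (0 : ℝ)..R, ω r * g r ^ 2) + ∫ r in (0 : ℝ)..R, ω r * (1 - φ r ^ 2) * f r ^ 2 := by
    rw [← intervalIntegral.integral_add (hint (by fun_prop) _ _) (hint (by fun_prop) _ _)]
    refine integral_congr fun r _ => ?_
    simp only [hg]
    ring
  -- (ii) the truncated part lives on `[0, r₁]`
  have hA : ∫ r in (0 : ℝ)..R, ω r * g r ^ 2 ≤ lam * M * ((∫ r in (0 : ℝ)..R, r * f' r ^ 2) +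
      C₁ / r₁ ^ 2 * X) := by
    have h1 : ∫ r in (0 : ℝ)..R, ω r * g r ^ 2 = ∫ r in (0 : ℝ)..r₁, ω r * g r ^ 2 := by
      rw [← integral_add_adjacent_intervals (b := r₁) (hint (by fun_prop) _ _)
        (hint (by fun_prop) _ _)]
      have hz : ∫ r in r₁..R, ω r * g r ^ 2 = 0 := by
        rw [integral_congr (g := fun _ => (0 : ℝ)) fun r hr => ?_, intervalIntegral.integral_zero]
        rw [uIcc_of_le hR] at hr
        simp only [hgzero r hr.1, zero_pow two_ne_zero, mul_zero]
      rw [hz, add_zero]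
    have h2 : ∫ r in (0 : ℝ)..r₁, ω r * g r ^ 2 ≤ lam * ∫ r in (0 : ℝ)..r₁, w r * g r ^ 2 := by
      rw [← intervalIntegral.integral_const_mul]
      refine integral_mono_on hr₁.le (hint (by fun_prop) _ _) (hint (by fun_prop) _ _)
        fun r hr => ?_
      rw [← mul_assoc]
      exact mul_le_mul_of_nonneg_right (hωw r hr) (sq_nonneg _)
    have h3 : lam * ∫ r in (0 : ℝ)..r₁, w r * g r ^ 2 ≤
        lam * M * ((∫ r in (0 : ℝ)..R, r * f' r ^ 2) + C₁ / r₁ ^ 2 * X) := by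
      rw [mul_assoc]
      refine mul_le_mul_of_nonneg_left (hcore.trans (mul_le_mul_of_nonneg_left
        (htrunc.trans ?_) hM0)) hlam
      gcongr
    linarith
  -- (iv) the outer part lives on `[r₁/2, R]`
  have hB : ∫ r in (0 : ℝ)..R, ω r * (1 - φ r ^ 2) * f r ^ 2 ≤ 4 * Θ / r₁ ^ 2 * X := by
    rw [← integral_add_adjacent_intervals (b := r₁ / 2) (hint (by fun_prop) _ _)
      (hint (by fun_prop) _ _)]
    have hz : ∫ r in (0 : ℝ)..(r₁ / 2), ω r * (1 - φ r ^ 2) * f r ^ 2 = 0 := by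
      rw [integral_congr (g := fun _ => (0 : ℝ)) fun r hr => ?_, intervalIntegral.integral_zero]
      rw [uIcc_of_le hr₁2] at hr
      simp only [hφ, radialCutoff_eq_one hr₁ hr.2, one_pow, sub_self, mul_zero, zero_mul]
    rw [hz, zero_add, hX, ← intervalIntegral.integral_const_mul]
    refine integral_mono_on hhalfR (hint (by fun_prop) _ _) (hint (by fun_prop) _ _) fun r hr => ?_
    have hr0 : 0 < r := (half_pos hr₁).trans_le hr.1
    have hφsq : 0 ≤ 1 - φ r ^ 2 :=
      sub_nonneg.2 (pow_le_one₀ (radialCutoff_nonneg r₁ r) (radialCutoff_le_one r₁ r))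
    have hφsq1 : 1 - φ r ^ 2 ≤ 1 := sub_le_self _ (sq_nonneg _)
    -- `ω (1 - φ²) f² ≤ ω f² ≤ (Θ/r) f² ≤ (4Θ/r₁²) r f²`
    have h1 : ω r * (1 - φ r ^ 2) * f r ^ 2 ≤ ω r * f r ^ 2 := by
      have : ω r * (1 - φ r ^ 2) ≤ ω r := mul_le_of_le_one_right (hω0 r) hφsq1
      exact mul_le_mul_of_nonneg_right this (sq_nonneg _)
    have h2 : ω r ≤ Θ / r := by
      rw [le_div_iff₀ hr0, mul_comm]
      exact hωΘ r hr0
    have h3 : Θ / r ≤ 4 * Θ / r₁ ^ 2 * r := by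
      rw [div_le_iff₀ hr0]
      have : r₁ ^ 2 ≤ 4 * (r * r) := by nlinarith [hr.1]
      have hΘr : Θ * r₁ ^ 2 ≤ Θ * (4 * (r * r)) := mul_le_mul_of_nonneg_left this hΘ
      calc Θ = Θ * r₁ ^ 2 / r₁ ^ 2 := by field_simp
        _ ≤ Θ * (4 * (r * r)) / r₁ ^ 2 := by gcongr
        _ = 4 * Θ / r₁ ^ 2 * r * r := by ring
    calc ω r * (1 - φ r ^ 2) * f r ^ 2 ≤ ω r * f r ^ 2 := h1
      _ ≤ Θ / r * f r ^ 2 := mul_le_mul_of_nonneg_right h2 (sq_nonneg _)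
      _ ≤ 4 * Θ / r₁ ^ 2 * r * f r ^ 2 := mul_le_mul_of_nonneg_right h3 (sq_nonneg _)
      _ = 4 * Θ / r₁ ^ 2 * (f r ^ 2 * r) := by ring
  -- assemble
  rw [hsplit]
  have hfin : lam * M * ((∫ r in (0 : ℝ)..R, r * f' r ^ 2) + C₁ / r₁ ^ 2 * X) + 4 * Θ / r₁ ^ 2 * X =
      lam * M * (∫ r in (0 : ℝ)..R, r * f' r ^ 2) + (lam * M * C₁ + 4 * Θ) / r₁ ^ 2 * X := by
    ring
  linarith

/-- **Wei 2016, Lemma 2.3, (2.3), along a ray.** Let `0 < ε`, `0 < a`, `1 ≤ K`,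
`0 < r₁ ≤ εK/a`, `r₁ ≤ R`; `w ≥ 0` continuous with `w ≤ ε/r` and `∫₀ʳ w ≤ r a` on `(0, r₁]` and
`r w(r) ≤ Γ` for `r > 0` (`Γ = ‖Γ‖_{L^∞}` along the ray); `f` differentiable with continuous
derivative. Then, with `M = ε(1 + ln K + ½ (ln K)²)` (`= ε^{-1/3}` for `K = K(ε)`) and the
absolute constant `C = hardyConst`,
`∫₀ᴿ w f² dr ≤ M ∫₀ᴿ r f'² dr + C (Γ + M)/r₁² ∫_{r₁/2}^R f² r dr`
— the ray form of (2.3), `∫ (|u_θ|/r)|f|² dx ≤ ε^{-1/3} ∫ |∂ᵣf|² dx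
+ C (‖Γ‖_∞ + ε^{-1/3})/r₁² ∫_{r ≥ r₁/2} |f|² dx` (`dx = r dr dθ dz`), for every finite `R`
(the printed integrals over `(0, ∞)` follow by monotone convergence for `f ∈ H¹`).
[cite: Wei2016, Lemma 2.3, (2.3)] -/
theorem integral_mul_sq_le_hardy_cutoff {w f f' : ℝ → ℝ} {ε a K r₁ R Γ : ℝ} (hε : 0 < ε)
    (ha : 0 < a) (hK : 1 ≤ K) (hr₁ : 0 < r₁) (hr₁K : r₁ ≤ ε * K / a) (hR : r₁ ≤ R)
    (hw : Continuous w) (hw0 : ∀ r, 0 ≤ w r) (hwε : ∀ r ∈ Ioc 0 r₁, w r ≤ ε / r)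
    (hV : ∀ r ∈ Ioc 0 r₁, ∫ s in (0 : ℝ)..r, w s ≤ r * a) (hΓ : ∀ r, 0 < r → r * w r ≤ Γ)
    (hf : ∀ r, HasDerivAt f (f' r) r) (hf' : Continuous f') :
    ∫ r in (0 : ℝ)..R, w r * f r ^ 2 ≤
      ε * (1 + Real.log K + Real.log K ^ 2 / 2) * (∫ r in (0 : ℝ)..R, r * f' r ^ 2) +
        hardyConst * (Γ + ε * (1 + Real.log K + Real.log K ^ 2 / 2)) / r₁ ^ 2 *
          ∫ r in (r₁ / 2)..R, f r ^ 2 * r := by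
  obtain ⟨hD0, hD⟩ := stDerivBound_spec
  obtain ⟨hD₂0, hD₂⟩ := stDeriv₂Bound_spec
  set M : ℝ := ε * (1 + Real.log K + Real.log K ^ 2 / 2) with hMdef
  have hlogK : 0 ≤ Real.log K := Real.log_nonneg hK
  have hM0 : 0 ≤ M := by positivity
  have hΓ0 : 0 ≤ Γ := by
    have h := hΓ 1 one_pos
    rw [one_mul] at h
    exact (hw0 1).trans h
  have hωw : ∀ r ∈ Icc 0 r₁, w r ≤ 1 * w r := fun r _ => by rw [one_mul]
  have h := integral_weight_mul_sq_le (ω := w) (lam := 1) (Θ := Γ) hε ha hK hr₁ hr₁K hR hw hw0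
    hwε hV hw hw0 zero_le_one hωw hΓ0 hΓ hf hf' hD0 hD hD₂
  rw [one_mul] at h
  refine h.trans (add_le_add le_rfl ?_)
  have hX0 : 0 ≤ ∫ r in (r₁ / 2)..R, f r ^ 2 * r :=
    intervalIntegral.integral_nonneg (by linarith) fun r hr => by
      have : 0 ≤ r := le_trans (by positivity) hr.1
      positivity
  refine mul_le_mul_of_nonneg_right ?_ hX0
  refine div_le_div_of_nonneg_right ?_ (by positivity)
  have hC := truncConst_le_hardyConst
  have h4 := four_le_hardyConst
  have hC0 := hardyConst_nonneg
  nlinarith [mul_le_mul_of_nonneg_left hC hM0, mul_le_mul_of_nonneg_left h4 hΓ0]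

/-- **Wei 2016, Lemma 2.3, (2.4), along a ray.** Under the hypotheses of
`integral_mul_sq_le_hardy_cutoff`,
`∫₀ᴿ r w² f² dr ≤ εM ∫₀ᴿ r f'² dr + C (Γ² + εM)/r₁² ∫_{r₁/2}^R f² r dr`
(`εM = ε^{2/3}` for `K = K(ε)`) — the ray form of (2.4),
`∫ |u_θ|²|f|² dx ≤ ε^{2/3} ∫ |∂ᵣf|² dx + C (‖Γ‖²_∞ + ε^{2/3})/r₁² ∫_{r ≥ r₁/2} |f|² dx`: on
`r ≤ r₁`, `r w² = |Γ| · (|u_θ|/r) ≤ ε w`, and on `r ≥ r₁/2`, `r w² = |Γ|²/r`.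
[cite: Wei2016, Lemma 2.3, (2.4)] -/
theorem integral_mul_sq_mul_sq_le_hardy_cutoff {w f f' : ℝ → ℝ} {ε a K r₁ R Γ : ℝ} (hε : 0 < ε)
    (ha : 0 < a) (hK : 1 ≤ K) (hr₁ : 0 < r₁) (hr₁K : r₁ ≤ ε * K / a) (hR : r₁ ≤ R)
    (hw : Continuous w) (hw0 : ∀ r, 0 ≤ w r) (hwε : ∀ r ∈ Ioc 0 r₁, w r ≤ ε / r)
    (hV : ∀ r ∈ Ioc 0 r₁, ∫ s in (0 : ℝ)..r, w s ≤ r * a) (hΓ : ∀ r, 0 < r → r * w r ≤ Γ)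
    (hf : ∀ r, HasDerivAt f (f' r) r) (hf' : Continuous f') :
    ∫ r in (0 : ℝ)..R, r * w r ^ 2 * f r ^ 2 ≤
      ε * (ε * (1 + Real.log K + Real.log K ^ 2 / 2)) * (∫ r in (0 : ℝ)..R, r * f' r ^ 2) +
        hardyConst * (Γ ^ 2 + ε * (ε * (1 + Real.log K + Real.log K ^ 2 / 2))) / r₁ ^ 2 *
          ∫ r in (r₁ / 2)..R, f r ^ 2 * r := by
  obtain ⟨hD0, hD⟩ := stDerivBound_spec
  obtain ⟨hD₂0, hD₂⟩ := stDeriv₂Bound_spec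
  set M : ℝ := ε * (1 + Real.log K + Real.log K ^ 2 / 2) with hMdef
  have hlogK : 0 ≤ Real.log K := Real.log_nonneg hK
  have hM0 : 0 ≤ M := by positivity
  have hΓ0 : 0 ≤ Γ := by
    have h := hΓ 1 one_pos
    rw [one_mul] at h
    exact (hw0 1).trans h
  -- the weight `ω = r w²`
  have hω : Continuous fun r => r * w r ^ 2 := by fun_prop
  have hrw : ∀ r ∈ Icc 0 r₁, r * w r ≤ ε := by
    intro r hr
    rcases hr.1.eq_or_lt with h0 | hpos
    · rw [← h0, zero_mul]
      exact hε.le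
    · have h := hwε r ⟨hpos, hr.2⟩
      rwa [le_div_iff₀ hpos, mul_comm] at h
  -- nonnegativity of `ω` needs `r ≥ 0`; we apply the general lemma to `ω r = max r 0 * w r ^ 2`
  set ω : ℝ → ℝ := fun r => max r 0 * w r ^ 2 with hωdef
  have hωc : Continuous ω := by
    simp only [hωdef]
    fun_prop
  have hω0' : ∀ r, 0 ≤ ω r := fun r => by
    simp only [hωdef]
    positivity
  have hωw : ∀ r ∈ Icc 0 r₁, ω r ≤ ε * w r := by
    intro r hr
    simp only [hωdef, max_eq_left hr.1]
    calc r * w r ^ 2 = r * w r * w r := by ring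
      _ ≤ ε * w r := mul_le_mul_of_nonneg_right (hrw r hr) (hw0 r)
  have hωΘ : ∀ r, 0 < r → r * ω r ≤ Γ ^ 2 := by
    intro r hr
    simp only [hωdef, max_eq_left hr.le]
    have h1 : 0 ≤ r * w r := mul_nonneg hr.le (hw0 r)
    calc r * (r * w r ^ 2) = (r * w r) ^ 2 := by ring
      _ ≤ Γ ^ 2 := pow_le_pow_left₀ h1 (hΓ r hr) 2
  have h := integral_weight_mul_sq_le (ω := ω) (lam := ε) (Θ := Γ ^ 2) hε ha hK hr₁ hr₁K hR hw
    hw0 hwε hV hωc hω0' hε.le hωw (sq_nonneg Γ) hωΘ hf hf' hD0 hD hD₂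
  -- the integrand `ω f²` agrees with `r w² f²` on `[0, R]`
  have heq : ∫ r in (0 : ℝ)..R, r * w r ^ 2 * f r ^ 2 = ∫ r in (0 : ℝ)..R, ω r * f r ^ 2 := by
    refine integral_congr fun r hr => ?_
    rw [uIcc_of_le (hr₁.le.trans hR)] at hr
    simp only [hωdef, max_eq_left hr.1]
  rw [heq]
  refine h.trans (add_le_add le_rfl ?_)
  have hX0 : 0 ≤ ∫ r in (r₁ / 2)..R, f r ^ 2 * r :=
    intervalIntegral.integral_nonneg (by linarith) fun r hr => by
      have : 0 ≤ r := le_trans (by positivity) hr.1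
      positivity
  refine mul_le_mul_of_nonneg_right ?_ hX0
  refine div_le_div_of_nonneg_right ?_ (by positivity)
  have hC := truncConst_le_hardyConst
  have h4 := four_le_hardyConst
  have hC0 := hardyConst_nonneg
  have hεM : 0 ≤ ε * M := by positivity
  have h1 := mul_le_mul_of_nonneg_left hC hεM
  have h2 := mul_le_mul_of_nonneg_left h4 (sq_nonneg Γ)
  simp only [hMdef] at h1 hεM ⊢
  nlinarith [h1, h2]

end Wei2016

end Literature.Analysis.FluidPDE

end
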